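import Literature.AlgebraicGeometry.Milne1999.CMTypeSubquotients
import Literature.AlgebraicGeometry.HodgeTheory.NonCMEllipticCurvesProductsHodgeClasses
import HarnessLib

/-!
# `E₀^{N₀+1} × ⋯ × E_r^{N_r+1} × A` is of CM-type iff every `E_i` and `A` are

Deligne, *Hodge cycles on abelian varieties*, LNM 900 (1982), §5 p. 63: «`A` is of CM-type if and
only if each `A_α` is of CM-type»; Milne, Compositio Math. 117 (1999), §2 p. 54 (CM-type via the
simple isogeny factors).  For the products of powers `multiPowSucc r E N = E₀^{N₀+1} × ⋯ × E_r^{N_r+1}`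
of the tree (`HodgeTheory/NonCMEllipticCurvesProductsHodgeClasses`; the carrier of the «pure elliptic
class» and of the `(∏ E_i^{n_i}) × A` theorems of `EllipticCurvesCMTypeProductsHodgeConjecture`) this
file PROVES, from `isOfCMType_prod_iff` / `isOfCMType_powSucc_iff` (`Milne1999/CMTypeSubquotients`)
and isogeny invariance:

* `isOfCMType_multiPowSucc_iff` — `E₀^{N₀+1} × ⋯ × E_r^{N_r+1}` is of CM-type iff every `E_i` is;
* `isOfCMType_multiPowSucc_prod_iff` — `(E₀^{N₀+1} × ⋯ × E_r^{N_r+1}) × A` is of CM-type iff every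
  `E_i` and `A` are;
* `isOfCMType_iff_of_isIsogenous_multiPowSucc(_prod)` — the same for any `X` ISOGENOUS to such a
  product; `not_isOfCMType_of_isIsogenous_multiPowSucc_prod` — one non-CM factor `E_i` makes `X`
  non-CM (e.g. the classes `X ~ ∏ E_i^{n_i} × A` with the `E_i` without complex multiplication are
  never of CM-type);
* `isOfCMType_multiPowSucc_prod` — the `⇐` direction for `(∏ E_i^{N_i+1}) × A` by name (for the bare
  product it is the tree's `isOfCMType_multiPowSucc` of `EllipticCurvesCMTypeProductsHodgeConjecture`,
  not imported here to keep this file light; `(isOfCMType_multiPowSucc_iff r E N).2` is the same map).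

The `E_i` need not be elliptic curves (no dimension hypothesis).  No definition, no named fact.

## References
* [Deligne1982HodgeCycles] P. Deligne, LNM 900 (1982), §5 p. 63.
* [Milne1999] J. S. Milne, Compositio Math. 117 (1999), §2 p. 54.
* [Gordon1997] B. B. Gordon, *A survey of the Hodge conjecture for abelian varieties* (1997), §3
  (products of powers of elliptic curves).
-/

noncomputable section

open CategoryTheory

namespace Literature.AlgebraicGeometry.HodgeTheory

open Literature.AlgebraicGeometry.Motives Literature.AlgebraicGeometry.Motives.AbelianVariety
open Literature.AlgebraicGeometry.Milne1999

/-- **`E₀^{N₀+1} × ⋯ × E_r^{N_r+1}` is of CM-type iff every `E_i` is** (induction along the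
bracketing of `multiPowSucc`: `isOfCMType_powSucc_iff`, `isOfCMType_prod_iff`).
[cite: Deligne1982HodgeCycles, §5 p. 63] [cite: Milne1999, §2 p. 54] -/
theorem isOfCMType_multiPowSucc_iff :
    ∀ (r : ℕ) (E : Fin (r + 1) → AbelianVariety ℂ) (N : Fin (r + 1) → ℕ),
      IsOfCMType (multiPowSucc r E N) ↔ ∀ i, IsOfCMType (E i)
  | 0, E, N => by
    rw [multiPowSucc, isOfCMType_powSucc_iff, Fin.forall_fin_one]
  | r + 1, E, N => by
    rw [multiPowSucc, isOfCMType_prod_iff, isOfCMType_multiPowSucc_iff r, isOfCMType_powSucc_iff]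
    exact (Fin.forall_fin_succ' (P := fun i => IsOfCMType (E i))).symm

/-- Each factor `E_i` of a CM product of powers is of CM-type. [cite: Deligne1982HodgeCycles, §5 p. 63]
[cite: Milne1999, §2 p. 54] -/
theorem isOfCMType_of_isOfCMType_multiPowSucc {r : ℕ} {E : Fin (r + 1) → AbelianVariety ℂ}
    {N : Fin (r + 1) → ℕ} (h : IsOfCMType (multiPowSucc r E N)) (i : Fin (r + 1)) : IsOfCMType (E i) :=
  (isOfCMType_multiPowSucc_iff r E N).1 h i

/-- **`(E₀^{N₀+1} × ⋯ × E_r^{N_r+1}) × A` is of CM-type iff every `E_i` and `A` are.**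
[cite: Deligne1982HodgeCycles, §5 p. 63] [cite: Milne1999, §2 p. 54] -/
theorem isOfCMType_multiPowSucc_prod_iff (r : ℕ) (E : Fin (r + 1) → AbelianVariety ℂ)
    (N : Fin (r + 1) → ℕ) (A : AbelianVariety ℂ) :
    IsOfCMType ((multiPowSucc r E N).prod A) ↔ (∀ i, IsOfCMType (E i)) ∧ IsOfCMType A := by
  rw [isOfCMType_prod_iff, isOfCMType_multiPowSucc_iff]

/-- `⇐` by name for `(∏ E_i^{N_i+1}) × A`. [cite: Deligne1982HodgeCycles, §5 p. 63] [cite: Milne1999, §2 p. 54] -/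
theorem isOfCMType_multiPowSucc_prod (r : ℕ) (E : Fin (r + 1) → AbelianVariety ℂ)
    (N : Fin (r + 1) → ℕ) {A : AbelianVariety ℂ} (hE : ∀ i, IsOfCMType (E i)) (hA : IsOfCMType A) :
    IsOfCMType ((multiPowSucc r E N).prod A) :=
  (isOfCMType_multiPowSucc_prod_iff r E N A).2 ⟨hE, hA⟩

/-- **An abelian variety isogenous to `E₀^{N₀+1} × ⋯ × E_r^{N_r+1}` is of CM-type iff every `E_i`
is** (isogeny invariance, `isOfCMType_iff_of_isIsogenous`). [cite: Milne1999, §2 p. 54]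
[cite: Deligne1982HodgeCycles, §5 p. 63] -/
theorem isOfCMType_iff_of_isIsogenous_multiPowSucc (r : ℕ) (E : Fin (r + 1) → AbelianVariety ℂ)
    (N : Fin (r + 1) → ℕ) {X : AbelianVariety ℂ} (hX : X.IsIsogenous (multiPowSucc r E N)) :
    IsOfCMType X ↔ ∀ i, IsOfCMType (E i) := by
  rw [isOfCMType_iff_of_isIsogenous hX, isOfCMType_multiPowSucc_iff]

/-- **An abelian variety isogenous to `(E₀^{N₀+1} × ⋯ × E_r^{N_r+1}) × A` is of CM-type iff every
`E_i` and `A` are.** [cite: Milne1999, §2 p. 54] [cite: Deligne1982HodgeCycles, §5 p. 63] -/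
theorem isOfCMType_iff_of_isIsogenous_multiPowSucc_prod (r : ℕ) (E : Fin (r + 1) → AbelianVariety ℂ)
    (N : Fin (r + 1) → ℕ) (A : AbelianVariety ℂ) {X : AbelianVariety ℂ}
    (hX : X.IsIsogenous ((multiPowSucc r E N).prod A)) :
    IsOfCMType X ↔ (∀ i, IsOfCMType (E i)) ∧ IsOfCMType A := by
  rw [isOfCMType_iff_of_isIsogenous hX, isOfCMType_multiPowSucc_prod_iff]

/-- **One non-CM factor `E_i` makes every `X ~ (∏ E_j^{N_j+1}) × A` non-CM** — so the classes
«isogenous to a product of powers of NON-CM elliptic curves times a CM abelian variety» of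
`EllipticCurvesCMTypeProductsHodgeConjecture` never meet the CM abelian varieties.
[cite: Milne1999, §2 p. 54] [cite: Deligne1982HodgeCycles, §5 p. 63] -/
theorem not_isOfCMType_of_isIsogenous_multiPowSucc_prod (r : ℕ) (E : Fin (r + 1) → AbelianVariety ℂ)
    (N : Fin (r + 1) → ℕ) (A : AbelianVariety ℂ) {X : AbelianVariety ℂ}
    (hX : X.IsIsogenous ((multiPowSucc r E N).prod A)) {i : Fin (r + 1)} (hi : ¬ IsOfCMType (E i)) :
    ¬ IsOfCMType X :=
  fun h => hi (((isOfCMType_iff_of_isIsogenous_multiPowSucc_prod r E N A hX).1 h).1 i)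

/-- The same without the CM factor `A`: one non-CM `E_i` makes every `X ~ ∏ E_j^{N_j+1}` non-CM.
[cite: Milne1999, §2 p. 54] [cite: Deligne1982HodgeCycles, §5 p. 63] -/
theorem not_isOfCMType_of_isIsogenous_multiPowSucc (r : ℕ) (E : Fin (r + 1) → AbelianVariety ℂ)
    (N : Fin (r + 1) → ℕ) {X : AbelianVariety ℂ} (hX : X.IsIsogenous (multiPowSucc r E N))
    {i : Fin (r + 1)} (hi : ¬ IsOfCMType (E i)) : ¬ IsOfCMType X :=
  fun h => hi ((isOfCMType_iff_of_isIsogenous_multiPowSucc r E N hX).1 h i)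

/-- The CM factor `A` of a CM `X ~ (∏ E_j^{N_j+1}) × A` is of CM-type — and conversely a non-CM `A`
makes `X` non-CM. [cite: Milne1999, §2 p. 54] [cite: Deligne1982HodgeCycles, §5 p. 63] -/
theorem not_isOfCMType_of_isIsogenous_multiPowSucc_prod_of_right (r : ℕ)
    (E : Fin (r + 1) → AbelianVariety ℂ) (N : Fin (r + 1) → ℕ) {A X : AbelianVariety ℂ}
    (hX : X.IsIsogenous ((multiPowSucc r E N).prod A)) (hA : ¬ IsOfCMType A) : ¬ IsOfCMType X :=
  fun h => hA ((isOfCMType_iff_of_isIsogenous_multiPowSucc_prod r E N A hX).1 h).2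

end Literature.AlgebraicGeometry.HodgeTheory
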